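import Literature.NumberTheory.LFunctions.NicolasMertensRHProofs
import HarnessLib

/-!
# RH-EQUIVALENT — Nicolas's criteria: `RH ⟺ N_k/φ(N_k) > e^γ log log N_k` for all `k ≥ 1` (1983), and the `c(n)` criteria (2012)

RH-EQUIVALENT (statements of the form `RiemannHypothesis ↔ …`, plus their one-sided halves);
nothing here bears on the truth of RH. Literature-typing tranche 1 (Broughan, *Equivalents of the
Riemann Hypothesis* vol. 1, Ch. 5 "Euler's totient function", pp. 94–143), whose principal results
are Nicolas's two theorems:

* **Nicolas 1983, Thm. 2** (J. Number Theory 17; restated in Nicolas 2012, p. 311: "In [Nicolas 1983]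
  it is proved that the Riemann hypothesis is equivalent to
  `∀ k ≥ 1, N_k/φ(N_k) > e^γ log log N_k`", `N_k = 2·3⋯p_k`; Heath-Brown's review of Broughan vol. 1,
  zbMATH 1427.11001: "a result of Nicolas, that RH holds if and only if `N_k/φ(N_k) > e^γ log log N_k`
  for every `k ≥ 1`"). Part (b) of the theorem — if RH fails the inequality holds for infinitely
  many `k` and fails for infinitely many `k` — is PROVED in the tree
  (`Nicolas.Nicolas1983_thm2b`, `NicolasMertensRHProofs.lean`); part (a) (under RH, all `k ≥ 1`) is
  not, and needs Nicolas 2012 (1.7) plus a computation over `k ≤ 120568`. So the equivalence is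
  recorded as the NAMED FACT `nicolas_iff`, while its `⟸` half
  (`riemannHypothesis_of_nicolasInequality_primorial`) and the "eventually" variant are PROVED.
* **Nicolas 2012, Thm. 1.1 and Cor. 1.1** (Acta Arith. 155, arXiv:1202.0729 p. 3; MacKay's review of
  Broughan, LMS Newsletter 480, quotes the form (1.5)): with
  `c(n) = (n/φ(n) − e^γ log log n) √(log n)` and `β = 2 + γ − log π − 2 log 2` (the tree's
  `nicolasBeta`), under RH: (1.4) `lim sup c(n) = e^γ(2+β)`; (1.5) `c(n) < e^γ(2+β)` for
  `n ≥ N_120569 = 2·3⋯1591883`; (1.6) `c(n) ≤ c(N_66) = c(2·3⋯317)` for `n ≥ 2`; (1.7)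
  `c(N_k) ≥ c(N_1) = c(2)` for `k ≥ 1`; and (Cor. 1.1) "each of the four assertions (1.4)–(1.7) is
  equivalent to the Riemann hypothesis", because (p. 3) if RH fails then, by the `Ω±`-theorem (1.10)
  for `log f`, `c` is unbounded above and below along the primorials. Thm. 1.1 is the NAMED FACT
  `Nicolas2012_thm1_1`; the `¬RH` statement is the NAMED FACT `Nicolas2012_nicolasC_primorial_unbounded`
  (the tree proves (1.10) itself, `Nicolas1983_logf_omega_holds`, but not the transfer
  `log f(p_k) ∼ (φ(N_k)/N_k) c(N_k)/√(log N_k)` of p. 3); the four equivalences of Cor. 1.1 are then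
  PROVED from these two facts (`riemannHypothesis_iff_nicolasC_…`).

AS-PRINTED FLAGS. (1) `N_k` ranges over the primorials of order `k ≥ 1`; we index them by their
largest prime, `N = p#` (`primorial p`, Mathlib) for `p` prime — the same set of integers — exactly as
the tree's `Nicolas1983_thm2b` does. (2) Nicolas's "lim inf c(n) = −∞" over all `n` is trivially true
(along the primes `c(p) → −∞` unconditionally); what Cor. 1.1 (for (1.7)) uses, and what the printed
derivation "from (1.10)" gives, is unboundedness of `c(N_k)` in both directions ALONG THE PRIMORIALS
when RH fails — this is what `Nicolas2012_nicolasC_primorial_unbounded` states. (3) `lim sup` in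
(1.4) is spelled out in `ε`-form (eventually `< L + ε`, frequently `> L − ε`) to avoid the junk value
of `Filter.limsup` on unbounded real sequences.

## References

* J.-L. Nicolas, *Petites valeurs de la fonction d'Euler*, J. Number Theory 17 (1983), 375–388,
  Thm. 2 (a), (b). [Nicolas1983]
* J.-L. Nicolas, *Small values of the Euler function and the Riemann hypothesis*, Acta Arith. 155
  (2012), 311–321 (arXiv:1202.0729): (1.2) `c(n)`, (1.3) `β`, Thm. 1.1 (1.4)–(1.7), Cor. 1.1, and
  p. 3 (unboundedness of `c` if RH fails, from (1.10)). [Nicolas2012] (held)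
* K. Broughan, *Equivalents of the Riemann Hypothesis. Vol. 1*, CUP 2017, Ch. 5 (pp. 94–143).
  [Broughan2017Arithmetic] (not held, acq-00318; statements as quoted in the reviews
  zbMATH 1427.11001 and LMS Newsletter 480 and read from the primary sources)
-/

noncomputable section

open Real Filter

namespace Literature.NumberTheory.LFunctions

/-! ### Nicolas's inequality and the 1983 criterion -/

/-- **Nicolas's inequality** at `n`: `e^γ log log n < n/φ(n)` (Nicolas 1983, Thm. 2, stated there at
the primorials `n = N_k`; Nicolas 2012 (1.1)). `γ = Real.eulerMascheroniConstant`, `φ = Nat.totient`.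
[cite: Nicolas1983, Thm. 2] -/
def nicolasInequality (n : ℕ) : Prop :=
  rexp eulerMascheroniConstant * Real.log (Real.log n) < (n : ℝ) / Nat.totient n

/-- Unfolding lemma for `nicolasInequality`. [cite: Nicolas1983, Thm. 2] -/
theorem nicolasInequality_iff (n : ℕ) :
    nicolasInequality n ↔
      rexp eulerMascheroniConstant * Real.log (Real.log n) < (n : ℝ) / Nat.totient n :=
  Iff.rfl

/-- NAMED FACT **Nicolas's criterion** (Nicolas 1983, Thm. 2; as restated in Nicolas 2012, p. 311:
"the Riemann hypothesis is equivalent to `∀ k ≥ 1, N_k/φ(N_k) > e^γ log log N_k`", `N_k` the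
product of the first `k` primes; Broughan vol. 1, Ch. 5). The primorials `N_k`, `k ≥ 1`, are indexed
here by their largest prime: `N = p#` for `p` prime (Mathlib's `primorial`). The `⟸` half is PROVED
below (`riemannHypothesis_of_nicolasInequality_primorial`, from the tree's `Nicolas.Nicolas1983_thm2b`);
the `⟹` half (Thm. 2 (a): under RH the inequality holds at every `N_k`) is not yet in the tree.
Users take `(h : nicolas_iff)`.
[cite: Nicolas1983, Thm. 2; Nicolas2012, p. 311; Broughan2017Arithmetic, Ch. 5 (pp. 94–143)] -/
def nicolas_iff : Prop :=
  RiemannHypothesis ↔ ∀ p : ℕ, p.Prime → nicolasInequality (primorial p)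

/-- **Nicolas 1983, Thm. 2, the `⟸` half (PROVED)**: if Nicolas's inequality holds at every primorial
`p#`, `p` prime, then RH holds — since if RH fails it fails at infinitely many primorials
(`Nicolas.Nicolas1983_thm2b`). [cite: Nicolas1983, Thm. 2 (b)] -/
theorem riemannHypothesis_of_nicolasInequality_primorial
    (h : ∀ p : ℕ, p.Prime → nicolasInequality (primorial p)) : RiemannHypothesis := by
  by_contra hRH
  obtain ⟨-, hfail⟩ := Nicolas.Nicolas1983_thm2b hRH
  obtain ⟨p, hp, -, hlt⟩ := hfail 0
  exact lt_asymm hlt (h p hp)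

/-- **Nicolas 1983, Thm. 2, eventual form of the `⟸` half (PROVED)**: if Nicolas's inequality holds at
every primorial `p#` with `p` prime and `p ≥ K`, then RH holds (if RH fails, the inequality fails for
arbitrarily large `p`, `Nicolas.Nicolas1983_thm2b`). [cite: Nicolas1983, Thm. 2 (b)] -/
theorem riemannHypothesis_of_nicolasInequality_primorial_eventually {K : ℝ}
    (h : ∀ p : ℕ, p.Prime → K ≤ p → nicolasInequality (primorial p)) : RiemannHypothesis := by
  by_contra hRH
  obtain ⟨-, hfail⟩ := Nicolas.Nicolas1983_thm2b hRH
  obtain ⟨p, hp, hKp, hlt⟩ := hfail K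
  exact lt_asymm hlt (h p hp hKp.le)

/-- From the named fact `nicolas_iff`: RH is also equivalent to Nicolas's inequality holding at all
primorials `p#` beyond any bound (Nicolas 1983, Thm. 2 (a)+(b): under RH it holds at all of them; if
RH fails it fails at infinitely many). [cite: Nicolas1983, Thm. 2] -/
theorem nicolas_iff.eventually_iff (hN : nicolas_iff) (K : ℝ) :
    RiemannHypothesis ↔ ∀ p : ℕ, p.Prime → K ≤ p → nicolasInequality (primorial p) :=
  ⟨fun hRH p hp _ => hN.1 hRH p hp,
    fun h => riemannHypothesis_of_nicolasInequality_primorial_eventually h⟩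

/-! ### Nicolas's `c(n)` and the 2012 criteria -/

/-- Nicolas's `c(n) = (n/φ(n) − e^γ log log n) √(log n)` (Nicolas 2012, (1.2)).
[cite: Nicolas2012, (1.2)] -/
def nicolasC (n : ℕ) : ℝ :=
  ((n : ℝ) / Nat.totient n - rexp eulerMascheroniConstant * Real.log (Real.log n)) *
    Real.sqrt (Real.log n)

/-- `c(n) > 0` iff Nicolas's inequality holds at `n`, for `n ≥ 2` (`√(log n) > 0`).
[cite: Nicolas2012, (1.1)-(1.2)] -/
theorem nicolasC_pos_iff {n : ℕ} (hn : 2 ≤ n) : 0 < nicolasC n ↔ nicolasInequality n := by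
  have hlog : 0 < Real.sqrt (Real.log n) :=
    Real.sqrt_pos.2 (Real.log_pos (by exact_mod_cast hn))
  rw [nicolasC, mul_pos_iff_of_pos_right hlog, sub_pos, nicolasInequality]

/-- The limit value `e^γ (2 + β) = 3.6444150964…` of Nicolas 2012, Thm. 1.1 (1.4), with `β` the tree's
`nicolasBeta = 2 + γ − log π − 2 log 2` (Nicolas 2012, (1.3)). [cite: Nicolas2012, Thm. 1.1 (1.4)] -/
def nicolasCLimsup : ℝ :=
  rexp eulerMascheroniConstant * (2 + nicolasBeta)

/-- NAMED FACT **Nicolas 2012, Thm. 1.1** (Acta Arith. 155, (1.4)–(1.7)): under the Riemann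
hypothesis, with `c = nicolasC` and `L = e^γ(2+β) = nicolasCLimsup`:
(1.4) `lim sup_{n→∞} c(n) = L` (in `ε`-form: for every `ε > 0`, eventually `c(n) < L + ε` and
frequently `c(n) > L − ε`);
(1.5) `c(n) < L` for every `n ≥ N_120569 = 2·3⋯1591883` (`= primorial 1591883`);
(1.6) `c(n) ≤ c(N_66) = c(2·3⋯317) = 4.0628356921…` for every `n ≥ 2`;
(1.7) `c(N_k) ≥ c(N_1) = c(2) = 2.2085892614…` for every `k ≥ 1` (primorials indexed by their largest
prime `p`, `N = p#`). Users take `(h : Nicolas2012_thm1_1)`.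
[cite: Nicolas2012, Thm. 1.1 (1.4)-(1.7); Broughan2017Arithmetic, Ch. 5 (pp. 94–143)] -/
def Nicolas2012_thm1_1 : Prop :=
  RiemannHypothesis →
    (∀ ε : ℝ, 0 < ε →
        (∀ᶠ n : ℕ in atTop, nicolasC n < nicolasCLimsup + ε) ∧
          (∃ᶠ n : ℕ in atTop, nicolasCLimsup - ε < nicolasC n)) ∧
      (∀ n : ℕ, primorial 1591883 ≤ n → nicolasC n < nicolasCLimsup) ∧
      (∀ n : ℕ, 2 ≤ n → nicolasC n ≤ nicolasC (primorial 317)) ∧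
      (∀ p : ℕ, p.Prime → nicolasC 2 ≤ nicolasC (primorial p))

/-- NAMED FACT (Nicolas 2012, p. 3, the unconditional input of Cor. 1.1): "it follows from (1.10)
[if RH fails, `log f(x) = Ω±(x^{−b})` for some `0 < b < 1/2` — the tree's
`Nicolas1983_logf_omega_holds`] that, if RH does not hold, then `lim inf c(n) = −∞` and
`lim sup c(n) = +∞`", obtained through `log f(p_k) ∼ (φ(N_k)/N_k) · c(N_k)/√(log N_k)` (p. 3), i.e.
ALONG THE PRIMORIALS (as-printed flag (2) of the module docstring: over all `n` the `lim inf` claim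
is empty, `c(p) → −∞` along the primes). Statement: if RH fails then for every real `A` there are
arbitrarily large primes `p` with `c(p#) < A`, and arbitrarily large primes `p` with `A < c(p#)`.
Users take `(h : Nicolas2012_nicolasC_primorial_unbounded)`.
[cite: Nicolas2012, p. 3 (lim inf / lim sup of c if RH fails, from (1.10)); Nicolas1983, Thm. 3 (c)] -/
def Nicolas2012_nicolasC_primorial_unbounded : Prop :=
  ¬ RiemannHypothesis →
    (∀ A X : ℝ, ∃ p : ℕ, p.Prime ∧ X < p ∧ nicolasC (primorial p) < A) ∧
      (∀ A X : ℝ, ∃ p : ℕ, p.Prime ∧ X < p ∧ A < nicolasC (primorial p))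

/-! ### Nicolas 2012, Cor. 1.1: each of (1.4)–(1.7) is equivalent to RH (PROVED from the two facts) -/

/-- `2 ≤ p#` for `p ≥ 2`. [folklore] -/
private theorem two_le_primorial {p : ℕ} (hp : 2 ≤ p) : 2 ≤ primorial p :=
  le_trans (le_trans hp le_primorial_self) le_rfl

/-- **Nicolas 2012, Cor. 1.1 for (1.5) (PROVED from the named facts)**: RH iff
`c(n) < e^γ(2+β)` for every `n ≥ N_120569 = primorial 1591883`.
[cite: Nicolas2012, Cor. 1.1 with Thm. 1.1 (1.5); Broughan2017Arithmetic, Ch. 5] -/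
theorem riemannHypothesis_iff_nicolasC_lt_of (h₁ : Nicolas2012_thm1_1)
    (h₂ : Nicolas2012_nicolasC_primorial_unbounded) :
    RiemannHypothesis ↔ ∀ n : ℕ, primorial 1591883 ≤ n → nicolasC n < nicolasCLimsup := by
  refine ⟨fun hRH => (h₁ hRH).2.1, fun h => ?_⟩
  by_contra hRH
  obtain ⟨p, -, hXp, hA⟩ := (h₂ hRH).2 nicolasCLimsup 1591883
  have hp' : 1591883 ≤ p := by exact_mod_cast hXp.le
  exact lt_asymm hA (h (primorial p) (primorial_mono hp'))

/-- **Nicolas 2012, Cor. 1.1 for (1.6) (PROVED from the named facts)**: RH iff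
`c(n) ≤ c(N_66) = c(primorial 317)` for every `n ≥ 2`.
[cite: Nicolas2012, Cor. 1.1 with Thm. 1.1 (1.6); Broughan2017Arithmetic, Ch. 5] -/
theorem riemannHypothesis_iff_nicolasC_le_c66_of (h₁ : Nicolas2012_thm1_1)
    (h₂ : Nicolas2012_nicolasC_primorial_unbounded) :
    RiemannHypothesis ↔ ∀ n : ℕ, 2 ≤ n → nicolasC n ≤ nicolasC (primorial 317) := by
  refine ⟨fun hRH => (h₁ hRH).2.2.1, fun h => ?_⟩
  by_contra hRH
  obtain ⟨p, hp, -, hA⟩ := (h₂ hRH).2 (nicolasC (primorial 317)) 0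
  exact not_lt.2 (h (primorial p) (two_le_primorial hp.two_le)) hA

/-- **Nicolas 2012, Cor. 1.1 for (1.7) (PROVED from the named facts)**: RH iff
`c(N_k) ≥ c(2)` for every primorial `N_k = p#`, `p` prime.
[cite: Nicolas2012, Cor. 1.1 with Thm. 1.1 (1.7); Broughan2017Arithmetic, Ch. 5] -/
theorem riemannHypothesis_iff_nicolasC_two_le_of (h₁ : Nicolas2012_thm1_1)
    (h₂ : Nicolas2012_nicolasC_primorial_unbounded) :
    RiemannHypothesis ↔ ∀ p : ℕ, p.Prime → nicolasC 2 ≤ nicolasC (primorial p) := by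
  refine ⟨fun hRH => (h₁ hRH).2.2.2, fun h => ?_⟩
  by_contra hRH
  obtain ⟨p, hp, -, hA⟩ := (h₂ hRH).1 (nicolasC 2) 0
  exact not_lt.2 (h p hp) hA

/-- **Nicolas 2012, Cor. 1.1 for (1.4) (PROVED from the named facts)**: RH iff
`lim sup c(n) = e^γ(2+β)` (in `ε`-form). The `⟸` half only uses the upper half of the `lim sup`
statement: if RH fails, `c` is unbounded above along the primorials.
[cite: Nicolas2012, Cor. 1.1 with Thm. 1.1 (1.4); Broughan2017Arithmetic, Ch. 5] -/
theorem riemannHypothesis_iff_nicolasC_limsup_of (h₁ : Nicolas2012_thm1_1)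
    (h₂ : Nicolas2012_nicolasC_primorial_unbounded) :
    RiemannHypothesis ↔
      ∀ ε : ℝ, 0 < ε →
        (∀ᶠ n : ℕ in atTop, nicolasC n < nicolasCLimsup + ε) ∧
          (∃ᶠ n : ℕ in atTop, nicolasCLimsup - ε < nicolasC n) := by
  refine ⟨fun hRH => (h₁ hRH).1, fun h => ?_⟩
  by_contra hRH
  obtain ⟨hev, -⟩ := h 1 one_pos
  obtain ⟨N, hN⟩ := eventually_atTop.1 hev
  obtain ⟨p, -, hXp, hA⟩ := (h₂ hRH).2 (nicolasCLimsup + 1) N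
  have hNp : N ≤ primorial p := le_trans (by exact_mod_cast hXp.le) le_primorial_self
  exact lt_asymm hA (hN (primorial p) hNp)

end Literature.NumberTheory.LFunctions

end
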